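import Summits.QuantumFields.YangMills.Theorems.ParabolicTrajectoryTunedSequenceExistsUniformFreezing
import Literature.MathematicalPhysics.QuantumFieldTheory.ActionDensityTimeReflection

/-!
# `TunedSequenceExists` (stmt-QuantumFields-10524), line `fixed-aspect-window`:
# uniform freezing of the two MIRROR correlators — bounded separations of the stubs
# `stub_mirrorBoundIn` / `stub_mirrorBoundOut` are free

By-product of the worker on stub `stub_mirrorBoundIn` (seat c4, `--supports stmt-QuantumFields-10524`).
`P = actionDensity ρ` is Wilson's corner action density, `Pᴿ := P ∘ cfgReflect` its time mirror.
Proved here, for every compact `G` and continuous unitary `ρ`, on EVERY torus, at EVERY coupling: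

* `abs_cov_le_mul_integral` — `|E[XY] − E[X] E[Y]| ≤ M · E[X]` for `[0, M]`-valued `X, Y`;
* `abs_latticeConnectedCorr_le_of_bounds` — for observables `A, B` with values in `[-c, c]`,
  `|⟨A ; τ_n B⟩_{β,S}| ≤ 2c ∫ (c − A(Ũ)) dμ_{β,S}` and `≤ 2c ∫ (c − B(Ũ)) dμ_{β,S}` (no equality of
  means needed: translation invariance of the torus state only);
* `abs_mirrorCorr_le_deficit` — both mirror correlators `⟨P ; τ_n Pᴿ⟩`, `⟨Pᴿ ; τ_n P⟩` are bounded by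
  `2 c_N ∫ (c_N − P(Ũ)) dμ_{β,S}`; with `UniformFreezing.uniform_plaquette_freezing`:
  **`uniform_mirror_freezing[_rep]`** — `sup_{S,n} (|⟨P ; τ_n Pᴿ⟩_{β,S}| + |⟨Pᴿ ; τ_n P⟩_{β,S}|) → 0`
  as `β → ∞`;
* for the line: **`mirrorBounds_of_sep_le`** — for every `K > 0` and every cap `D₀` there is `β₁`
  with `D⁸ |⟨P ; τ_D Pᴿ⟩_{β,2L+1}| ≤ K` and `D⁸ |⟨Pᴿ ; τ_D P⟩_{β,2L+1}| ≤ K` for all `β ≥ β₁`, ALL `L`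
  and all `D ≤ D₀`.  So the stubs `stub_mirrorBoundIn/Out` (canonical upper bounds `D⁸ |·| ≤ K`,
  `β ≥ β₁`, all `L`, `D ≤ L`) are statements about the joint regime `D → ∞` only (any refuting
  family must have unbounded separations), exactly as (V) is about `m → ∞`
  (`UniformFreezing.volumeMonotone_iff_allDepths`).

References: Osterwalder–Seiler 1978 §2 (the reflection); the freezing input is
`…UniformFreezing` (Chatterjee 2016 §7-type small-ball bound, there for `U(N)` on cubes).
-/

noncomputable section

open Filter Topology MeasureTheory
open Literature.MathematicalPhysics.QuantumFieldTheory Literature.MathematicalPhysics.QuantumLattice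
open Summit.QuantumFields.YangMills.Theorems.TunedSequenceExists.Negative.Freezing
open Summit.QuantumFields.YangMills.Theorems.TunedSequenceExists.UniformFreezing

namespace Summit.QuantumFields.YangMills.Theorems.TunedSequenceExists.MirrorFreezing

/-! ## An elementary covariance bound -/

/-- For `[0, M]`-valued random variables, `|E[XY] − E[X] E[Y]| ≤ M · E[X]`: both `E[XY]` and
`E[X] E[Y]` lie in `[0, M E[X]]`. [folklore] -/
theorem abs_cov_le_mul_integral {Ω : Type*} [MeasurableSpace Ω] (μ : Measure Ω)
    [IsProbabilityMeasure μ] {X Y : Ω → ℝ} {M : ℝ} (hX : Measurable X) (hY : Measurable Y)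
    (hX0 : ∀ ω, 0 ≤ X ω) (hXM : ∀ ω, X ω ≤ M) (hY0 : ∀ ω, 0 ≤ Y ω) (hYM : ∀ ω, Y ω ≤ M) :
    |∫ ω, X ω * Y ω ∂μ - (∫ ω, X ω ∂μ) * ∫ ω, Y ω ∂μ| ≤ M * ∫ ω, X ω ∂μ := by
  have hbd : ∀ {f : Ω → ℝ}, Measurable f → (∀ ω, 0 ≤ f ω) → (∀ ω, f ω ≤ M) → Integrable f μ :=
    fun hf h0 hM => Integrable.of_bound hf.aestronglyMeasurable M (ae_of_all _ fun ω => by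
      rw [Real.norm_eq_abs, abs_of_nonneg (h0 ω)]; exact hM ω)
  have iX : Integrable X μ := hbd hX hX0 hXM
  have iXY : Integrable (fun ω => X ω * Y ω) μ := by
    refine Integrable.of_bound (hX.mul hY).aestronglyMeasurable (M * M) (ae_of_all _ fun ω => ?_)
    rw [Real.norm_eq_abs, abs_of_nonneg (mul_nonneg (hX0 ω) (hY0 ω))]
    exact mul_le_mul (hXM ω) (hYM ω) (hY0 ω) ((hX0 ω).trans (hXM ω))
  have hIX0 : 0 ≤ ∫ ω, X ω ∂μ := integral_nonneg hX0
  have hIY0 : 0 ≤ ∫ ω, Y ω ∂μ := integral_nonneg hY0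
  have hIYM : ∫ ω, Y ω ∂μ ≤ M := by
    calc ∫ ω, Y ω ∂μ ≤ ∫ _ω, M ∂μ := integral_mono (hbd hY hY0 hYM) (integrable_const _) hYM
      _ = M := by simp
  have hup : ∫ ω, X ω * Y ω ∂μ ≤ M * ∫ ω, X ω ∂μ := by
    calc ∫ ω, X ω * Y ω ∂μ ≤ ∫ ω, M * X ω ∂μ :=
          integral_mono iXY (iX.const_mul _) fun ω => by
            rw [mul_comm M]; exact mul_le_mul_of_nonneg_left (hYM ω) (hX0 ω)
      _ = M * ∫ ω, X ω ∂μ := integral_const_mul _ _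
  have hlow : 0 ≤ ∫ ω, X ω * Y ω ∂μ := integral_nonneg fun ω => mul_nonneg (hX0 ω) (hY0 ω)
  have hprod : (∫ ω, X ω ∂μ) * ∫ ω, Y ω ∂μ ≤ M * ∫ ω, X ω ∂μ := by
    rw [mul_comm M]; exact mul_le_mul_of_nonneg_left hIYM hIX0
  have hprod0 : 0 ≤ (∫ ω, X ω ∂μ) * ∫ ω, Y ω ∂μ := mul_nonneg hIX0 hIY0
  rw [abs_le]
  constructor <;> linarith

/-! ## The torus: connected correlators of bounded observables -/

section Torus

variable {G : Type} [Group G] [TopologicalSpace G] [IsTopologicalGroup G] [CompactSpace G]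
  [MeasurableSpace G] [BorelSpace G] {N : ℕ}

/-- **Connected correlators of `[-c, c]`-valued observables are controlled by either mean deficit**:
`|⟨A ; τ_n B⟩_{β,S}| ≤ 2c ∫ (c − A(Ũ)) dμ_{β,S}` and `≤ 2c ∫ (c − B(Ũ)) dμ_{β,S}`, for every coupling,
side and separation (translation invariance of the torus Wilson state; no reflection positivity).
[folklore] -/
theorem abs_latticeConnectedCorr_le_of_bounds {S : ℕ} [NeZero S] (ρ : G →* Matrix (Fin N) (Fin N) ℂ)
    (hρ : Continuous ρ) (β : ℝ) {A B : LGConfig 4 G → ℝ} (hA : Measurable A) (hB : Measurable B)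
    {c : ℝ} (hA1 : ∀ V, A V ≤ c) (hA2 : ∀ V, -c ≤ A V) (hB1 : ∀ V, B V ≤ c) (hB2 : ∀ V, -c ≤ B V)
    (n : ℕ) :
    |latticeConnectedCorr ρ β S A B n| ≤
        2 * c * ∫ U, (c - A (torusLift S U)) ∂(wilsonMeasure (d := 4) (L := S) ρ β) ∧
      |latticeConnectedCorr ρ β S A B n| ≤
        2 * c * ∫ U, (c - B (torusLift S U)) ∂(wilsonMeasure (d := 4) (L := S) ρ β) := by
  set μ := wilsonMeasure (d := 4) (L := S) ρ β with hμ
  haveI := isProbabilityMeasure_wilsonMeasure (d := 4) (L := S) ρ hρ β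
  set v : Literature.Probability.LatticeModels.Site 4 := -Pi.single 0 (n : ℤ) with hv
  set X : GaugeConfig 4 S G → ℝ := fun U => c - A (torusLift S U) with hX
  set Y : GaugeConfig 4 S G → ℝ := fun U => c - B (configShift v (torusLift S U)) with hY
  have hmA : Measurable fun U : GaugeConfig 4 S G => A (torusLift S U) :=
    hA.comp (measurable_torusLift S)
  have hmB : Measurable fun U : GaugeConfig 4 S G => B (configShift v (torusLift S U)) :=
    hB.comp ((configShift v).measurable.comp (measurable_torusLift S))
  have hmX : Measurable X := measurable_const.sub hmA
  have hmY : Measurable Y := measurable_const.sub hmB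
  have hX0 : ∀ U, 0 ≤ X U := fun U => by simp only [hX]; linarith [hA1 (torusLift S U)]
  have hXM : ∀ U, X U ≤ 2 * c := fun U => by simp only [hX]; linarith [hA2 (torusLift S U)]
  have hY0 : ∀ U, 0 ≤ Y U := fun U => by
    simp only [hY]; linarith [hB1 (configShift v (torusLift S U))]
  have hYM : ∀ U, Y U ≤ 2 * c := fun U => by
    simp only [hY]; linarith [hB2 (configShift v (torusLift S U))]
  -- integrability of the bounded observables
  have hbd : ∀ {f : GaugeConfig 4 S G → ℝ}, Measurable f → (∀ U, -c ≤ f U) → (∀ U, f U ≤ c) →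
      Integrable f μ := fun hf h1 h2 =>
    Integrable.of_bound hf.aestronglyMeasurable |c| (ae_of_all _ fun U => by
      rw [Real.norm_eq_abs]; exact abs_le_abs (h2 U) (by linarith [h1 U]))
  have iA : Integrable (fun U => A (torusLift S U)) μ := hbd hmA (fun U => hA2 _) fun U => hA1 _
  have iB : Integrable (fun U => B (configShift v (torusLift S U))) μ :=
    hbd hmB (fun U => hB2 _) fun U => hB1 _
  have iAB : Integrable (fun U => A (torusLift S U) * B (configShift v (torusLift S U))) μ := by
    refine Integrable.of_bound (hmA.mul hmB).aestronglyMeasurable (|c| * |c|)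
      (ae_of_all _ fun U => ?_)
    rw [Real.norm_eq_abs, abs_mul]
    exact mul_le_mul (abs_le_abs (hA1 _) (by linarith [hA2 (torusLift S U)]))
      (abs_le_abs (hB1 _) (by linarith [hB2 (configShift v (torusLift S U))])) (abs_nonneg _)
      (abs_nonneg _)
  -- translation invariance of the mean of `B`
  have hmean : ∫ U, B (configShift v (torusLift S U)) ∂μ = ∫ U, B (torusLift S U) ∂μ :=
    integral_comp_configShift_torusLift (d := 4) (S := S) ρ β B v
  -- the correlator is the covariance of the two deficits
  have hcorr : latticeConnectedCorr ρ β S A B n =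
      ∫ U, X U * Y U ∂μ - (∫ U, X U ∂μ) * ∫ U, Y U ∂μ := by
    unfold latticeConnectedCorr
    rw [← hv, ← hμ, ← hmean]
    have e1 : ∫ U, X U * Y U ∂μ = c * c - c * ∫ U, B (configShift v (torusLift S U)) ∂μ -
        c * ∫ U, A (torusLift S U) ∂μ + ∫ U, A (torusLift S U) * B (configShift v (torusLift S U)) ∂μ := by
      have hexp : (fun U => X U * Y U) = fun U => c * c - c * B (configShift v (torusLift S U)) -
          c * A (torusLift S U) + A (torusLift S U) * B (configShift v (torusLift S U)) := by
        funext U; simp only [hX, hY]; ring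
      rw [hexp, integral_add, integral_sub, integral_sub, integral_const, integral_const_mul,
        integral_const_mul]
      · simp
      · exact integrable_const _
      · exact iB.const_mul _
      · exact (integrable_const _).sub (iB.const_mul _)
      · exact iA.const_mul _
      · exact ((integrable_const _).sub (iB.const_mul _)).sub (iA.const_mul _)
      · exact iAB
    have e2 : ∫ U, X U ∂μ = c - ∫ U, A (torusLift S U) ∂μ := by
      simp only [hX]; rw [integral_sub (integrable_const _) iA, integral_const]; simp
    have e3 : ∫ U, Y U ∂μ = c - ∫ U, B (configShift v (torusLift S U)) ∂μ := by
      simp only [hY]; rw [integral_sub (integrable_const _) iB, integral_const]; simp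
    rw [e1, e2, e3]
    ring
  refine ⟨?_, ?_⟩
  · rw [hcorr]
    exact abs_cov_le_mul_integral μ hmX hmY hX0 hXM hY0 hYM
  · have h := abs_cov_le_mul_integral μ hmY hmX hY0 hYM hX0 hXM
    have hswap : ∫ U, Y U * X U ∂μ - (∫ U, Y U ∂μ) * ∫ U, X U ∂μ =
        ∫ U, X U * Y U ∂μ - (∫ U, X U ∂μ) * ∫ U, Y U ∂μ := by
      simp only [mul_comm (Y _) (X _)]; ring
    rw [hswap, ← hcorr] at h
    refine h.trans (le_of_eq ?_)
    simp only [hY]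
    rw [integral_comp_configShift_torusLift (d := 4) (S := S) ρ β (fun W => c - B W) v]

variable [SecondCountableTopology G]

/-- **Both mirror correlators are controlled by the mean corner deficit**, for EVERY coupling, side
and separation: `|⟨P ; τ_n Pᴿ⟩_{β,S}|, |⟨Pᴿ ; τ_n P⟩_{β,S}| ≤ 2 c_N ∫ (c_N − P(Ũ)) dμ_{β,S}`
(`Pᴿ = P ∘ cfgReflect` is again `[-c_N, c_N]`-valued). [folklore] -/
theorem abs_mirrorCorr_le_deficit {S : ℕ} [NeZero S] (ρ : G →* Matrix (Fin N) (Fin N) ℂ)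
    (hρ : Continuous ρ) (hρu : ∀ g, ρ g ∈ Matrix.unitaryGroup (Fin N) ℂ) (β : ℝ) (n : ℕ) :
    |latticeConnectedCorr ρ β S (actionDensity ρ) (fun V => actionDensity ρ (cfgReflect V)) n| ≤
        2 * (∑ i : Fin 4, ∑ j : Fin 4, if i < j then (N : ℝ) else 0) *
          ∫ U, ((∑ i : Fin 4, ∑ j : Fin 4, if i < j then (N : ℝ) else 0) -
            actionDensity ρ (torusLift S U)) ∂(wilsonMeasure (d := 4) (L := S) ρ β) ∧
      |latticeConnectedCorr ρ β S (fun V => actionDensity ρ (cfgReflect V)) (actionDensity ρ) n| ≤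
        2 * (∑ i : Fin 4, ∑ j : Fin 4, if i < j then (N : ℝ) else 0) *
          ∫ U, ((∑ i : Fin 4, ∑ j : Fin 4, if i < j then (N : ℝ) else 0) -
            actionDensity ρ (torusLift S U)) ∂(wilsonMeasure (d := 4) (L := S) ρ β) := by
  have hρN : ∀ g, (ρ g).trace.re ≤ N := fun g =>
    (abs_le.1 (abs_re_trace_le_of_mem_unitaryGroup (hρu g))).2
  have hρN' : ∀ g, -(N : ℝ) ≤ (ρ g).trace.re := fun g =>
    (abs_le.1 (abs_re_trace_le_of_mem_unitaryGroup (hρu g))).1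
  set c : ℝ := (∑ i : Fin 4, ∑ j : Fin 4, if i < j then (N : ℝ) else 0) with hc
  have h1 : ∀ W, actionDensity ρ W ≤ c := fun W => by
    linarith [cN_sub_actionDensity_nonneg ρ hρN W]
  have h2 : ∀ W, -c ≤ actionDensity ρ W := fun W => by
    linarith [cN_sub_actionDensity_le ρ hρN' W]
  have hmP : Measurable (actionDensity ρ) := (continuous_actionDensity hρ).measurable
  have hmR : Measurable fun V : LGConfig 4 G => actionDensity ρ (cfgReflect V) :=
    hmP.comp measurable_cfgReflect
  exact ⟨(abs_latticeConnectedCorr_le_of_bounds ρ hρ β hmP hmR h1 h2 (fun V => h1 _)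
      (fun V => h2 _) n).1,
    (abs_latticeConnectedCorr_le_of_bounds ρ hρ β hmR hmP (fun V => h1 _) (fun V => h2 _) h1 h2 n).2⟩

/-- **Uniform mirror freezing.** For every compact group `G`, continuous unitary `ρ` and `ε > 0`
there is `β₀` such that `|⟨P ; τ_n Pᴿ⟩_{β,S}| ≤ ε` and `|⟨Pᴿ ; τ_n P⟩_{β,S}| ≤ ε` for all `β ≥ β₀`,
ALL sides `S` and ALL separations `n`. [folklore] -/
theorem uniform_mirror_freezing (ρ : G →* Matrix (Fin N) (Fin N) ℂ) (hρ : Continuous ρ)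
    (hρu : ∀ g, ρ g ∈ Matrix.unitaryGroup (Fin N) ℂ) {ε : ℝ} (hε : 0 < ε) :
    ∃ β₀ : ℝ, 0 < β₀ ∧ ∀ β : ℝ, β₀ ≤ β → ∀ (S : ℕ) [NeZero S] (n : ℕ),
      |latticeConnectedCorr ρ β S (actionDensity ρ) (fun V => actionDensity ρ (cfgReflect V)) n| ≤ ε ∧
      |latticeConnectedCorr ρ β S (fun V => actionDensity ρ (cfgReflect V)) (actionDensity ρ) n| ≤ ε := by
  have hρN : ∀ g, (ρ g).trace.re ≤ N := fun g =>
    (abs_le.1 (abs_re_trace_le_of_mem_unitaryGroup (hρu g))).2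
  set c : ℝ := (∑ i : Fin 4, ∑ j : Fin 4, if i < j then (N : ℝ) else 0) with hc
  have hc0 : 0 ≤ c := cN_nonneg N
  obtain ⟨β₀, hβ₀, h⟩ := uniform_plaquette_freezing ρ hρ hρN (show 0 < ε / (2 * c + 1) by positivity)
  refine ⟨β₀, hβ₀, fun β hβ S _ n => ?_⟩
  obtain ⟨hin, hout⟩ := abs_mirrorCorr_le_deficit (S := S) ρ hρ hρu β n
  have h2 := h β hβ S
  have hfin : 2 * c * (ε / (2 * c + 1)) ≤ ε := by
    rw [mul_div_assoc', div_le_iff₀ (by positivity)]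
    nlinarith
  have hkey : 2 * c * ∫ U, (c - actionDensity ρ (torusLift S U)) ∂(wilsonMeasure (d := 4) (L := S) ρ β) ≤ ε :=
    (mul_le_mul_of_nonneg_left h2 (by positivity)).trans hfin
  exact ⟨hin.trans hkey, hout.trans hkey⟩

end Torus

/-! ## Consequences for the line `fixed-aspect-window` (data `r : LatticeRep G`) -/

section Line

variable {G : Type} [Group G] [TopologicalSpace G] [IsTopologicalGroup G] [CompactSpace G]
  [MeasurableSpace G] [BorelSpace G]

/-- **Uniform mirror freezing for a lattice representation** (`P = r.curvature.F`). [folklore] -/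
theorem uniform_mirror_freezing_rep (r : LatticeRep G) {ε : ℝ} (hε : 0 < ε) :
    ∃ β₀ : ℝ, 0 < β₀ ∧ ∀ β : ℝ, β₀ ≤ β → ∀ (S : ℕ) [NeZero S] (n : ℕ),
      |latticeConnectedCorr r.ρ β S r.curvature.F (fun V => r.curvature.F (cfgReflect V)) n| ≤ ε ∧
      |latticeConnectedCorr r.ρ β S (fun V => r.curvature.F (cfgReflect V)) r.curvature.F n| ≤ ε := by
  haveI : SecondCountableTopology G := secondCountable_of_latticeRep r
  have hF : r.curvature.F = actionDensity r.ρ := rfl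
  rw [hF]
  exact uniform_mirror_freezing r.ρ r.continuous r.mem_unitary hε

/-- **Bounded separations of the mirror stubs are free, for every constant.** For every `K > 0` and
every cap `D₀` there is `β₁` such that for all `β ≥ β₁`, ALL half-sides `L` and all `D ≤ D₀`:
`D⁸ |⟨P ; τ_D Pᴿ⟩_{β,2L+1}| ≤ K` and `D⁸ |⟨Pᴿ ; τ_D P⟩_{β,2L+1}| ≤ K`.  Hence the content of
`stub_mirrorBoundIn` / `stub_mirrorBoundOut` is the joint regime `D → ∞` (so `L → ∞`) at `β ≥ β₁`.
[folklore] -/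
theorem mirrorBounds_of_sep_le (r : LatticeRep G) {K : ℝ} (hK : 0 < K) (D₀ : ℕ) :
    ∃ β₁ : ℝ, ∀ β : ℝ, β₁ ≤ β → ∀ (L D : ℕ), D ≤ D₀ →
      (D : ℝ) ^ 8 * |latticeConnectedCorr r.ρ β (2 * L + 1) r.curvature.F
          (fun V => r.curvature.F (cfgReflect V)) D| ≤ K ∧
      (D : ℝ) ^ 8 * |latticeConnectedCorr r.ρ β (2 * L + 1)
          (fun V => r.curvature.F (cfgReflect V)) r.curvature.F D| ≤ K := by
  have hD₀ : (0 : ℝ) < ((D₀ : ℝ) + 1) ^ 8 := by positivity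
  obtain ⟨β₀, -, h⟩ := uniform_mirror_freezing_rep r (show 0 < K / ((D₀ : ℝ) + 1) ^ 8 by positivity)
  refine ⟨β₀, fun β hβ L D hD => ?_⟩
  obtain ⟨hin, hout⟩ := h β hβ (2 * L + 1) D
  have hpow : (D : ℝ) ^ 8 ≤ ((D₀ : ℝ) + 1) ^ 8 :=
    pow_le_pow_left₀ (Nat.cast_nonneg _) (by exact_mod_cast Nat.le_succ_of_le hD) 8
  have hval : ((D₀ : ℝ) + 1) ^ 8 * (K / ((D₀ : ℝ) + 1) ^ 8) = K := by field_simp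
  constructor
  · calc (D : ℝ) ^ 8 * _ ≤ ((D₀ : ℝ) + 1) ^ 8 * (K / ((D₀ : ℝ) + 1) ^ 8) :=
          mul_le_mul hpow hin (abs_nonneg _) hD₀.le
      _ = K := hval
  · calc (D : ℝ) ^ 8 * _ ≤ ((D₀ : ℝ) + 1) ^ 8 * (K / ((D₀ : ℝ) + 1) ^ 8) :=
          mul_le_mul hpow hout (abs_nonneg _) hD₀.le
      _ = K := hval

end Line

end Summit.QuantumFields.YangMills.Theorems.TunedSequenceExists.MirrorFreezing

end
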